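import Literature.MathematicalPhysics.QuantumFieldTheory.Balaban1983to89.B4Ineq115Torus
import Literature.MathematicalPhysics.QuantumFieldTheory.Balaban1983to89.B4ThmZeroTorusEta

/-!
# `Balaban1983to89.B4Claim18ZeroTorusEta` — T. Bałaban, *Regularity and decay of lattice Green's functions*, Commun. Math. Phys. **89** (1983)
# 571–597 [Balaban1983RegularityDecay]: the in-text claim **(1.8)** p. 573 (`−Δ^{η,N}_{A,Ω} + aP_k(A) ≥ γ₀I`, typed `B4.Claim18Printed`)
# HOLDS for the ZERO-FIELD TORUS FAMILY `B4ThmZeroTorusEta.torusEtaFam` of Bałaban's concrete scalar tower — every volume, `Ω = T_η`, `A = 0`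

statement-level skeleton of published theorems with citation tags; proofs where landed; nothing here is a claim about the Yang–Mills mass gap

PDF held: `paper:balaban1983-cmp89-regularity-decay` (journal page = PDF page + 570), p. 573 [PDF 3] ((1.8)), p. 580 [PDF 10] ((2.27), the
mechanism at `A₀ = 0`), p. 572 [PDF 2] (the torus); read by this seat.

CITATION HEADER (lean-in-tree rule).  Cell `lit-balaban` (HOME `run/shared/lean/pub/lit-balaban/`), Phase-2 proof seat **p14** gen 10 (unit
`lit-balaban-p14`); SKELETON row **B4.Claim18** (decl of record `B4.Claim18Printed`, owner r01): its ZERO-FIELD TORUS FAMILY, in the SAME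
`B4.EtaSetting` currency in which p38 booked the Theorem p. 573 (`B4ThmZeroTorusEta.thmPrintedNN_torusEtaFam`, whose docstring records
«(vii) `lower18` is recorded, not proved here») and this seat booked Corollary 2.3 (`B4Cor23ZeroTorusEta.cor23Printed_torusEtaFam`); sibling
of b04's `B4Claim18Zero` (regions of `ℤ^{d+1}`) and `B4Lower18Regular`/`B4Lower18RegularRegion` (`A ≠ 0`, boxes / regular regions).  USED BY
NAME, never restated: p38's carrier `B4ThmZeroTorusEta.{TorusEtaIdx, torusEtaFam}` (whose `lower18 γ` field IS the form inequality
`γΣ_n‖v_n‖² ≤ Σ_n⟨v_n, (−Δ^ε + α_K Q*_KQ_K)v_n⟩` for the tower's top-level data), `B4Ineq115Torus.{Marg, Marg_coercive}` (block Poincaré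
on the torus), `B1RG242Torus.{tower, α, hOp, Qk, Qks}`, `B1.ainf_lt_aSeq` ((2.15) of [B1]: `a(1 − L⁻²) < a_k`), `Params.spacing_K` (`L^Kε = 1`).

WHAT IS PRINTED (verbatim).  p. 573 [PDF 3]: *"The operator defining the Green's function (1.6) has a strictly positive lower bound. More
exactly we prove that there exists a positive constant γ₀ such that for e sufficiently small and for a regular vector field A,
−Δ^{η,N}_{A,Ω} + aP_k(A) ≥ γ₀I. (1.8)  The constant γ₀ is independent of the lattice spacing η, as well as of Ω and of A."*; p. 580 [PDF 10]
(proof of Lemma 2.1, reduced to `A₀ = 0`): *"Now these bounds are consequences of quadratic form considerations. … The operator −Δ^{η,N}_□ is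
bounded from below by π² on a subspace of functions on □ orthogonal to constant functions, which are its eigenvectors corresponding to
eigenvalue 0. The operator P_k is an orthogonal projection on a subspace of constant functions, thus ⟨φ, (−Δ^{η,N}_□ + a_kP_k)φ⟩ ≥
min{π², a_k}‖φ‖²_{L²(□)}. (2.27)"*; p. 572 [PDF 2]: *"Another common case is to consider operators on subsets of a torus T_η which we identify
with a rectangular parallelepiped in ηZ^d with periodic conditions."*

WHAT THIS FILE PROVES (kernel-checked, zero `sorry`, theorems only; axioms standard).
* §1 `op18_eq_Marg`: the operator of the `lower18` field of the member `(P, e)` — `−Δ^ε + α_K • Q*_KQ_K` with the tower's `α_K = a_K(L^Kε)^{−2}`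
  — IS `B4Ineq115Torus.Marg P a 0 K` (the argument of `G_K^{resc}` at mass `0`; `L^Kε = 1`).
* §2 `form_lower18` / `form_lower18_unif`: `min{8, a_K}‖v‖² ≤ ⟨v, (−Δ^ε + α_KQ*_KQ_K)v⟩` and, uniformly in the volume,
  `min{8, a(1 − L⁻²)}‖v‖² ≤ …` (block Poincaré `Marg_coercive` + (2.15) `a(1 − L⁻²) < a_K`); componentwise sums `lower18_torusEtaFam_aSeq`,
  `lower18_torusEtaFam`.
* §3 **`claim18Printed_torusEtaFam`** — for `L > 1`, `a > 0`, every `d` and every `m²`: `B4.Claim18Printed (torusEtaFam d L a m²)` with the witness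
  `γ₀ = min{8, a(1 − L⁻²)}` (a function of `a, L` only — «independent of the lattice spacing η, as well as of Ω»), any `e₁` (the charge is idle at
  `A = 0`).
HONEST SCOPE.  `A = 0`, `U ≡ 1`, `Ω = T_η` only (the regularity hypothesis is `True` on this family); the instance level is the top level `k = K`
of each volume (`η = ε = L^{−K}`); the constant `8` of the torus block Poincaré inequality stands in for the printed `π²` of (2.27) (a weaker,
true constant; the printed `γ₀` is existential); the mass is excluded from the (1.8) operator exactly as typed by p38 (so `m²` is idle here and
NO sign condition on it is needed); `N = d` components as in p38's carrier; nothing here is summit progress.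
-/

namespace Literature.MathematicalPhysics.QuantumFieldTheory.Balaban1983to89

open Matrix Finset

noncomputable section

namespace B4Claim18ZeroTorusEta

open B1RG242Torus B4Ineq115Torus B4ThmZeroTorusEta

variable {P : Params}

/-! ## §1 The (1.8) operator of the torus member is `Marg P a 0 K` -/

/-- At the top level `K` (`L^Kε = 1`) the operator `−Δ^ε + α_K • Q*_KQ_K` of the `lower18` field (the tower's `α_K = a_K(L^Kε)^{−2} = a_K`)
is the argument `Marg P a 0 K = −Δ^{ε/(L^Kε)} + (L^Kε)²·0 + a_KQ*_KQ_K` of the rescaled Green's function at mass zero.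
[cite: Balaban1983RegularityDecay, (1.8) p.573; Balaban1982Higgs1, (2.22) p.610; bookkeeping] -/
theorem op18_eq_Marg (P : Params) (a msq : ℝ) :
    hOp P 0 P.eps 0 + (tower P a msq).α P.K • ((tower P a msq).Qks P.K * (tower P a msq).Qk P.K) = Marg P a 0 P.K := by
  show hOp P 0 P.eps 0 + α P a P.K • (Qks P P.K * Qk P P.K) = _
  rw [Marg, α, P.spacing_K, div_one, one_pow, inv_one, mul_one, one_mul]

/-! ## §2 The form lower bound -/

/-- **(1.8) at `A = 0` on the torus, one component, level constant**: `min{8, a_K}‖v‖² ≤ ⟨v, (−Δ^ε + α_KQ*_KQ_K)v⟩` for every real `v` on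
`T_ε` (block Poincaré on the `L^K`-blocks of `Q_K`, `B4Ineq115Torus.Marg_coercive` at mass `0`; the mechanism of (2.27) with `8` for `π²`).
[cite: Balaban1983RegularityDecay, (1.8) p.573, cf. (2.27) p.580] -/
theorem form_lower18 (P : Params) (a msq : ℝ) (v : Site P 0 → ℝ) :
    min 8 (B1.aSeq a P.L P.K) * (v ⬝ᵥ v) ≤
      v ⬝ᵥ ((hOp P 0 P.eps 0 + (tower P a msq).α P.K • ((tower P a msq).Qks P.K * (tower P a msq).Qk P.K)) *ᵥ v) := by
  rw [op18_eq_Marg]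
  exact Marg_coercive (P := P) (a := a) le_rfl P.K v

/-- **(1.8) at `A = 0` on the torus, one component, UNIFORM constant**: for `a > 0` and `K ≥ 1`,
`min{8, a(1 − L⁻²)}‖v‖² ≤ ⟨v, (−Δ^ε + α_KQ*_KQ_K)v⟩` ((2.15) of [B1]: `a(1 − L⁻²) < a_K`). [cite: Balaban1983RegularityDecay, (1.8) p.573
(«γ₀ is independent of the lattice spacing η, as well as of Ω»); Balaban1982Higgs1, (2.15) p.609] -/
theorem form_lower18_unif (P : Params) {a : ℝ} (ha : 0 < a) (msq : ℝ) (hK : 1 ≤ P.K) (v : Site P 0 → ℝ) :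
    min 8 (a * (1 - (((P.L : ℝ)) ^ 2)⁻¹)) * (v ⬝ᵥ v) ≤
      v ⬝ᵥ ((hOp P 0 P.eps 0 + (tower P a msq).α P.K • ((tower P a msq).Qks P.K * (tower P a msq).Qk P.K)) *ᵥ v) := by
  refine le_trans ?_ (form_lower18 P a msq v)
  exact mul_le_mul_of_nonneg_right (min_le_min_left 8 (B1.ainf_lt_aSeq ha (one_lt_cast_L P) P.K hK).le) (dot_self_nonneg v)

/-- The `lower18` field of the member `i = (P, e)` of the zero-field torus family holds with the level constant `min{8, a_K}`
(componentwise sum of `form_lower18`). [cite: Balaban1983RegularityDecay, (1.8) p.573, cf. (2.27) p.580] -/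
theorem lower18_torusEtaFam_aSeq (d L : ℕ) (a msq : ℝ) (i : TorusEtaIdx d L) :
    (torusEtaFam d L a msq i).lower18 (min 8 (B1.aSeq a i.P.L i.P.K)) := by
  intro v
  change Fin i.P.d → Site i.P 0 → ℝ at v
  show min 8 (B1.aSeq a i.P.L i.P.K) * ∑ n, v n ⬝ᵥ v n ≤
    ∑ n, v n ⬝ᵥ ((hOp i.P 0 i.P.eps 0 +
      (tower i.P a msq).α i.P.K • ((tower i.P a msq).Qks i.P.K * (tower i.P a msq).Qk i.P.K)) *ᵥ v n)
  rw [Finset.mul_sum]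
  exact Finset.sum_le_sum fun n _ => form_lower18 i.P a msq (v n)

/-- The `lower18` field of every member of the zero-field torus family holds with the UNIFORM constant `γ₀ = min{8, a(1 − L⁻²)}`
(`a > 0`; `K ≥ 1` is part of the index). [cite: Balaban1983RegularityDecay, (1.8) p.573; Balaban1982Higgs1, (2.15) p.609] -/
theorem lower18_torusEtaFam (d L : ℕ) {a : ℝ} (ha : 0 < a) (msq : ℝ) (i : TorusEtaIdx d L) :
    (torusEtaFam d L a msq i).lower18 (min 8 (a * (1 - (((L : ℝ)) ^ 2)⁻¹))) := by
  obtain ⟨P, hPd, hPL, hK, e⟩ := i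
  subst hPL
  intro v
  change Fin P.d → Site P 0 → ℝ at v
  show min 8 (a * (1 - (((P.L : ℕ) : ℝ) ^ 2)⁻¹)) * ∑ n, v n ⬝ᵥ v n ≤
    ∑ n, v n ⬝ᵥ ((hOp P 0 P.eps 0 +
      (tower P a msq).α P.K • ((tower P a msq).Qks P.K * (tower P a msq).Qk P.K)) *ᵥ v n)
  rw [Finset.mul_sum]
  exact Finset.sum_le_sum fun n _ => form_lower18_unif P ha msq hK (v n)

/-! ## §3 The typed claim (1.8) for the zero-field torus family -/

/-- **THE IN-TEXT CLAIM (1.8) FOR THE ZERO-FIELD TORUS FAMILY** (typed `B4.Claim18Printed` — «there exists a positive constant γ₀ such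
that for e sufficiently small and for a regular vector field A, −Δ^{η,N}_{A,Ω} + aP_k(A) ≥ γ₀I … γ₀ is independent of the lattice spacing
η, as well as of Ω and of A»): for `L > 1`, `a > 0`, every `d` and every `m²`, the family `torusEtaFam d L a m²` of ALL zero-field torus
instances `(P = (d, L, m, K), K ≥ 1, e)` of the concrete scalar tower satisfies it with `γ₀ = min{8, a(1 − L⁻²)}` and any threshold `e₁`
(here `e₁ = 1`; the charge is idle at `A = 0`, `regular = True`). [cite: Balaban1983RegularityDecay, (1.8) p.573, cf. (2.27) p.580] -/
theorem claim18Printed_torusEtaFam (d L : ℕ) (hL : 1 < L) {a : ℝ} (ha : 0 < a) (msq : ℝ) :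
    B4.Claim18Printed (torusEtaFam d L a msq) := by
  have hL' : (1 : ℝ) < L := by exact_mod_cast hL
  have hL2 : (1 : ℝ) < (L : ℝ) ^ 2 := by nlinarith
  have hγ : 0 < a * (1 - (((L : ℝ)) ^ 2)⁻¹) :=
    mul_pos ha (sub_pos.mpr (inv_lt_one_of_one_lt₀ hL2))
  refine ⟨min 8 (a * (1 - (((L : ℝ)) ^ 2)⁻¹)), 1, lt_min (by norm_num) hγ, one_pos, fun i _ _ _ => ?_⟩
  exact lower18_torusEtaFam d L ha msq i

end B4Claim18ZeroTorusEta

end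

end Literature.MathematicalPhysics.QuantumFieldTheory.Balaban1983to89
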